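import Summits.Schanuel.Schanuel.Statement
import Summits.Schanuel.Schanuel.Theorems.RootDecomp1EAnchorToolkit
import Literature.NumberTheory.Transcendental.LindemannWeierstrassProofs

/-!
# RootDecomp1 — the SATURATION LADDER: Schanuel ⟺ (finitary saturation) ∧ (Schanuel for saturated tuples);
the exponential-rank ladder `S ⟹ B ⟹ Def_c ⟹ UniformRankBound ⟹ FinitarySaturation ⟹ ExpMordellWeilFG`
and the return map `FinitarySaturation ∧ SaturatedSchanuel ⟹ S`

Lens-1 («grading / quantitative ladder») generation 25, unconditional lane (census-portable, 0 sorry).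
For a finite tuple `z` put `F_z = ℚ(z, e^z)` and let `Γ^alg(z) = {w ∈ ℂ : w and e^w are algebraic over F_z}` (a ℚ-subspace:
the exponential periods of the relative algebraic closure of `F_z`).  The SATURATION RANK `ρ(z) = rank_ℚ Γ^alg(z) ∈ ℕ ∪ {∞}`
is an invariant of `acl F_z`, as is `trdeg F_z`.  The graded statements, weakest last:

* `S`      : `ρ(z) ≤ trdeg F_z`                      (Schanuel; `= Theorems.schanuel_iff_forall_expRank_le_trdeg`, SoloInformed);
* `Def_c`  : `n ≤ trdeg F_z + c` for ℚ-l.i. `z`       (`c = 1` is DefectOneSchanuel, stmt-Schanuel-25020, verbatim binder below);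
* `URB`    : `rank Γ(K) ≤ f(trdeg K)` for f.g. `K`     (UniformRankBound, stmt-Schanuel-3490, verbatim binder / conclusion below);
* `FS`     : `ρ(z) < ∞` for every finite `z`          (`FinitarySaturation`, NEW named piece, this file);
* `FG`     : `rank Γ(K) < ∞` for f.g. `K`             (ExpMordellWeilFG, stmt-Schanuel-3489, verbatim conclusion below);
* `Sat`    : Schanuel for SATURATED tuples             (SaturatedSchanuel, stmt-Schanuel-25021, verbatim binder below).

Theorems (all kernel-checked, no new transcendence input except Hermite–Lindemann for the grade-0 cell):

* `schanuel_iff_finitarySaturation_and_saturated` : `S ⟺ FS ∧ Sat` — the ROOT CUT of this generation.  Proof of `⟸`: a bounded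
  ℚ-rank lets one pick a MAXIMAL ℚ-l.i. family `u ⊂ Γ^alg(z)`; maximality makes `u` saturated (everything exponential-algebraic over
  `F_u` is exponential-algebraic over `F_z`, hence in `span u`), `Sat` gives `|u| ≤ trdeg F_u ≤ trdeg F_z`, and `z ⊂ span u` gives
  `n ≤ |u|`.  So ALL the non-finiteness content of Schanuel's conjecture sits in `Sat`; what is left is a pure FINITENESS statement.
* `finitarySaturation_of_uniformRankBound` : `URB ⟹ FS`;  `expMordellWeilFG_of_finitarySaturation` : `FS ⟹ FG`;
  `uniformRankBound_of_defectLe` : `Def_c ⟹ URB` with `f = id + c`;  `uniformRankBound_of_defectOne` : `B ⟹ URB` (new cross-route edge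
  stmt-Schanuel-25020 ⟹ stmt-Schanuel-3490);  `schanuel_of_uniformRankBound_of_saturated` : `URB ∧ Sat ⟹ S` (new cross-route
  return edge stmt-Schanuel-3490 ∧ stmt-Schanuel-25021 ⟹ summit), generalising 1E's `B ∧ Sat ⟹ S`
  (`RootDecomp1EUnsaturatedCore01.schanuel_iff_defectOne_and_saturated`) two rungs down the ladder.
* `defectLe_iff_expRankExcess` : the dictionary `Def_c ⟺ (every subfield K has exponential rank ≤ trdeg K + c)` (the `c = 0` row is
  SoloInformed's normal form).
* `finitarySaturation_rank_zero` : the grade-0 cell of `FS` (empty `z`, `F_z = ℚ`) is DECIDED: `Γ^alg(∅) = 0` by Hermite–Lindemann.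
  First open grade: `trdeg F_z = 1` (`z = (1)`, `(log 2)`, `(iπ)`), inside Barrier B1's shadow like every defect-type axis.

Other routes' items enter ONLY as verbatim bodies (binders / conclusions); the `Iff.rfl` identifications with
`Theses.RootDecomp1E.SaturatedSchanuel`, `Theses.RootDecomp1(E).DefectOneSchanuel`, `Theses.ExpMordellWeil.UniformRankBound`,
`Theses.ExpMordellWeil.ExpMordellWeilFG` are certified in the sibling probe file `RootDecomp1SaturationLadderProbe.lean` (lens folder,
not for porting).  Imports stay on the RootDecomp1/1E cone (`RootDecomp1EAnchorToolkit`, shared item stmt-Schanuel-25020).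
-/


noncomputable section

namespace Summit.Schanuel.Schanuel.Theorems.RootDecomp1SaturationLadder

open Complex IntermediateField
open scoped Cardinal
open Summit.Schanuel.Schanuel.Theorems.RootDecomp1EAnchor (isAlgebraic_of_mem_adjoin isAlgebraic_of_le
  isAlgebraic_of_isAlgebraic_adjoin trdeg_adjoin_le_of_isAlgebraic trdeg_adjoin_le_nat)
open Literature.NumberTheory.Transcendental (transcendental_exp_holds)
open Literature.NumberTheory.Transcendental.OneMotiveToric (trdeg_mono)

/-! ## The new named piece -/

/-- **Finitary saturation** (`FS`): for every finite tuple `z`, the ℚ-space `Γ^alg(z)` of all `w` with `w` and `e^w` algebraic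
over `F_z = ℚ(z, e^z)` has finite ℚ-rank — every ℚ-linearly independent family in it has bounded length.  Equivalently: every
finitely generated subfield of `ℂ` has an E-saturation of finite rank.  Implied by `UniformRankBound` (stmt-Schanuel-3490), implies
`ExpMordellWeilFG` (stmt-Schanuel-3489); with `SaturatedSchanuel` (stmt-Schanuel-25021) it is equivalent to Schanuel's conjecture. -/
def FinitarySaturation : Prop :=
  ∀ (n : ℕ) (z : Fin n → ℂ), ∃ N : ℕ, ∀ (m : ℕ) (u : Fin m → ℂ),
    (∀ j, IsAlgebraic ↥(IntermediateField.adjoin ℚ (Set.range z ∪ Set.range (Complex.exp ∘ z))) (u j) ∧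
        IsAlgebraic ↥(IntermediateField.adjoin ℚ (Set.range z ∪ Set.range (Complex.exp ∘ z))) (Complex.exp (u j))) →
    LinearIndependent ℚ u → m ≤ N

/-! ## Field-theoretic helpers -/

/-- (private copy of the folklore lemma `Literature.Barriers.Schanuel.trdeg_adjoin_union_eq_of_isAlgebraic_adjoin`, whose home module
imports the modular-forms development) Adjoining elements algebraic over `K(S)` does not change `trdeg_K`. -/
private theorem trdeg_adjoin_union_eq_of_isAlgebraic_adjoin {K E : Type*} [Field K] [Field E]
    [Algebra K E] (S T : Set E) (hT : ∀ x ∈ T, IsAlgebraic (adjoin K S) x) :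
    Algebra.trdeg K (adjoin K (S ∪ T)) = Algebra.trdeg K (adjoin K S) := by
  haveI : FaithfulSMul (adjoin K S) (adjoin (adjoin K S) T) :=
    (faithfulSMul_iff_algebraMap_injective (adjoin K S) (adjoin (adjoin K S) T)).mpr
      (algebraMap (adjoin K S) (adjoin (adjoin K S) T)).injective
  have htower := trdeg_add_eq K (adjoin K S) (A := adjoin (adjoin K S) T)
  have heq : Algebra.trdeg K (adjoin (adjoin K S) T) = Algebra.trdeg K (adjoin K (S ∪ T)) := by
    rw [← (equivOfEq (adjoin_adjoin_left K S T)).trdeg_eq]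
    rfl
  haveI : Algebra.IsAlgebraic (adjoin K S) (adjoin (adjoin K S) T) :=
    IntermediateField.isAlgebraic_adjoin fun x hx => (hT x hx).isIntegral
  have h0 : Algebra.trdeg (adjoin K S) (adjoin (adjoin K S) T) = 0 := trdeg_eq_zero
  rw [h0, add_zero, heq] at htower
  exact htower.symm

/-- The generators `z i`, `e^{z i}` of `F_z` are (trivially) exponential-algebraic over `F_z`. -/
theorem gens_expAlgebraic {n : ℕ} (z : Fin n → ℂ) (i : Fin n) :
    IsAlgebraic ↥(adjoin ℚ (Set.range z ∪ Set.range (cexp ∘ z))) (z i) ∧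
      IsAlgebraic ↥(adjoin ℚ (Set.range z ∪ Set.range (cexp ∘ z))) (cexp (z i)) :=
  ⟨isAlgebraic_of_mem_adjoin (subset_adjoin ℚ _ (Or.inl ⟨i, rfl⟩)),
    isAlgebraic_of_mem_adjoin (subset_adjoin ℚ _ (Or.inr ⟨i, rfl⟩))⟩

/-- If every `u j`, `e^{u j}` is algebraic over `F_z`, then so is every generator of `F_u`. -/
theorem gens_isAlgebraic_of_expAlgebraic {n m : ℕ} {z : Fin n → ℂ} {u : Fin m → ℂ}
    (huP : ∀ j, IsAlgebraic ↥(adjoin ℚ (Set.range z ∪ Set.range (cexp ∘ z))) (u j) ∧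
      IsAlgebraic ↥(adjoin ℚ (Set.range z ∪ Set.range (cexp ∘ z))) (cexp (u j))) :
    ∀ x ∈ Set.range u ∪ Set.range (cexp ∘ u),
      IsAlgebraic ↥(adjoin ℚ (Set.range z ∪ Set.range (cexp ∘ z))) x := by
  rintro x (⟨j, rfl⟩ | ⟨j, rfl⟩)
  · exact (huP j).1
  · exact (huP j).2

/-- `F_z ≤ K` when `z ⊂ Γ(K)`. -/
theorem adjoin_le_of_mem {m : ℕ} {u : Fin m → ℂ} {K : IntermediateField ℚ ℂ}
    (huK : ∀ i, u i ∈ K ∧ cexp (u i) ∈ K) :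
    adjoin ℚ (Set.range u ∪ Set.range (cexp ∘ u)) ≤ K := by
  rw [adjoin_le_iff]
  rintro x (⟨j, rfl⟩ | ⟨j, rfl⟩)
  · exact (huK j).1
  · exact (huK j).2

/-- A ℚ-linearly independent `z : Fin n → ℂ` inside the span of `u : Fin m → ℂ` has `n ≤ m`. -/
theorem card_le_of_linearIndependent_of_mem_span {n m : ℕ} {z : Fin n → ℂ} {u : Fin m → ℂ}
    (hz : LinearIndependent ℚ z) (h : ∀ i, z i ∈ Submodule.span ℚ (Set.range u)) : n ≤ m := by
  classical
  have h1 := linearIndependent_le_span' z hz (Set.range u) (by rintro _ ⟨i, rfl⟩; exact h i)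
  rw [Cardinal.mk_fin] at h1
  have h1' : n ≤ Fintype.card (Set.range u) := by exact_mod_cast h1
  have h2 : Fintype.card (Set.range u) ≤ m := by
    simpa using Fintype.card_range_le u
  exact h1'.trans h2

/-- `trdeg F_z ≤ 2n`; in particular it is finite. -/
theorem trdeg_adjoin_le_two_mul {n : ℕ} (z : Fin n → ℂ) :
    Algebra.trdeg ℚ ↥(adjoin ℚ (Set.range z ∪ Set.range (cexp ∘ z))) ≤ ((n + n : ℕ) : Cardinal) := by
  refine trdeg_adjoin_le_nat _ ?_
  refine (Cardinal.mk_union_le _ _).trans ?_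
  have h1 : #(Set.range z) ≤ n := by simpa using Cardinal.mk_range_le (f := z)
  have h2 : #(Set.range (cexp ∘ z)) ≤ n := by simpa using Cardinal.mk_range_le (f := cexp ∘ z)
  simpa [Nat.cast_add] using add_le_add h1 h2

/-! ## The return map: a finite saturation rank plus Schanuel-for-saturated-tuples gives Schanuel at `z` -/

/-- **Local return lemma.**  If `Γ^alg(z)` has ℚ-rank bounded by `N` and Schanuel's inequality holds for saturated tuples
(stmt-Schanuel-25021, verbatim), then Schanuel's inequality holds at the ℚ-l.i. tuple `z`. -/
theorem le_trdeg_of_rankBound_of_saturated {n : ℕ} {z : Fin n → ℂ} (hz : LinearIndependent ℚ z) {N : ℕ}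
    (hN : ∀ (m : ℕ) (u : Fin m → ℂ),
      (∀ j, IsAlgebraic ↥(IntermediateField.adjoin ℚ (Set.range z ∪ Set.range (Complex.exp ∘ z))) (u j) ∧
          IsAlgebraic ↥(IntermediateField.adjoin ℚ (Set.range z ∪ Set.range (Complex.exp ∘ z))) (Complex.exp (u j))) →
      LinearIndependent ℚ u → m ≤ N)
    (hSat : ∀ (n : ℕ) (z : Fin n → ℂ), LinearIndependent ℚ z → (∀ w : ℂ, IsAlgebraic ↥(IntermediateField.adjoin ℚ (Set.range z ∪ Set.range (Complex.exp ∘ z))) w → IsAlgebraic ↥(IntermediateField.adjoin ℚ (Set.range z ∪ Set.range (Complex.exp ∘ z))) (Complex.exp w) → w ∈ Submodule.span ℚ (Set.range z)) → (n : Cardinal) ≤ Algebra.trdeg ℚ ↥(IntermediateField.adjoin ℚ (Set.range z ∪ Set.range (Complex.exp ∘ z)))) :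
    (n : Cardinal) ≤ Algebra.trdeg ℚ ↥(IntermediateField.adjoin ℚ (Set.range z ∪ Set.range (Complex.exp ∘ z))) := by
  classical
  set F : IntermediateField ℚ ℂ := adjoin ℚ (Set.range z ∪ Set.range (cexp ∘ z)) with hF
  -- admissible lengths of ℚ-l.i. families inside Γ^alg(z)
  let Q : ℕ → Prop := fun m => ∃ u : Fin m → ℂ, LinearIndependent ℚ u ∧
    ∀ j, IsAlgebraic ↥F (u j) ∧ IsAlgebraic ↥F (cexp (u j))
  have hQn : Q n := ⟨z, hz, gens_expAlgebraic z⟩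
  have hnN : n ≤ N := hN n z (gens_expAlgebraic z) hz
  set m₀ := Nat.findGreatest Q N with hm₀
  obtain ⟨u, hu, huP⟩ : Q m₀ := Nat.findGreatest_spec hnN hQn
  -- maximality: Γ^alg(z) ⊆ span u
  have hmax : ∀ w : ℂ, IsAlgebraic ↥F w → IsAlgebraic ↥F (cexp w) → w ∈ Submodule.span ℚ (Set.range u) := by
    intro w hw hew
    by_contra hws
    have hcons : LinearIndependent ℚ (Fin.cons w u : Fin (m₀ + 1) → ℂ) := hu.finCons hws
    have hconsP : ∀ j : Fin (m₀ + 1), IsAlgebraic ↥F ((Fin.cons w u : Fin (m₀ + 1) → ℂ) j) ∧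
        IsAlgebraic ↥F (cexp ((Fin.cons w u : Fin (m₀ + 1) → ℂ) j)) := by
      refine Fin.cases ?_ ?_
      · simpa using And.intro hw hew
      · intro j; simpa using huP j
    have hle : m₀ + 1 ≤ N := hN (m₀ + 1) _ hconsP hcons
    have := Nat.le_findGreatest (P := Q) hle ⟨_, hcons, hconsP⟩
    omega
  -- `u` is saturated
  have hgen := gens_isAlgebraic_of_expAlgebraic huP
  have hsatu : ∀ w : ℂ, IsAlgebraic ↥(adjoin ℚ (Set.range u ∪ Set.range (cexp ∘ u))) w →
      IsAlgebraic ↥(adjoin ℚ (Set.range u ∪ Set.range (cexp ∘ u))) (cexp w) →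
      w ∈ Submodule.span ℚ (Set.range u) := fun w hw hew =>
    hmax w (isAlgebraic_of_isAlgebraic_adjoin F hgen hw) (isAlgebraic_of_isAlgebraic_adjoin F hgen hew)
  have h1 : (m₀ : Cardinal) ≤ Algebra.trdeg ℚ ↥(adjoin ℚ (Set.range u ∪ Set.range (cexp ∘ u))) :=
    hSat m₀ u hu hsatu
  have h2 : Algebra.trdeg ℚ ↥(adjoin ℚ (Set.range u ∪ Set.range (cexp ∘ u))) ≤ Algebra.trdeg ℚ ↥F :=
    trdeg_adjoin_le_of_isAlgebraic hgen
  have h3 : n ≤ m₀ :=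
    card_le_of_linearIndependent_of_mem_span hz fun i => hmax _ (gens_expAlgebraic z i).1 (gens_expAlgebraic z i).2
  calc (n : Cardinal) ≤ (m₀ : Cardinal) := by exact_mod_cast h3
    _ ≤ _ := h1
    _ ≤ _ := h2

/-- **FS ∧ Sat ⟹ S.**  Finitary saturation and Schanuel-for-saturated-tuples (stmt-Schanuel-25021, verbatim) give Schanuel. -/
theorem schanuel_of_finitarySaturation_of_saturated (hFS : FinitarySaturation)
    (hSat : ∀ (n : ℕ) (z : Fin n → ℂ), LinearIndependent ℚ z → (∀ w : ℂ, IsAlgebraic ↥(IntermediateField.adjoin ℚ (Set.range z ∪ Set.range (Complex.exp ∘ z))) w → IsAlgebraic ↥(IntermediateField.adjoin ℚ (Set.range z ∪ Set.range (Complex.exp ∘ z))) (Complex.exp w) → w ∈ Submodule.span ℚ (Set.range z)) → (n : Cardinal) ≤ Algebra.trdeg ℚ ↥(IntermediateField.adjoin ℚ (Set.range z ∪ Set.range (Complex.exp ∘ z)))) :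
    _root_.Schanuel := by
  intro n z hz
  obtain ⟨N, hN⟩ := hFS n z
  exact le_trdeg_of_rankBound_of_saturated hz hN hSat

/-- **S ⟹ FS** (with the bound `N = 2n ≥ trdeg F_z`). -/
theorem finitarySaturation_of_schanuel (hS : _root_.Schanuel) : FinitarySaturation := by
  intro n z
  refine ⟨n + n, fun m u huP hu => ?_⟩
  have h1 : (m : Cardinal) ≤ Algebra.trdeg ℚ ↥(adjoin ℚ (Set.range u ∪ Set.range (cexp ∘ u))) := hS m u hu
  have h2 := trdeg_adjoin_le_of_isAlgebraic (gens_isAlgebraic_of_expAlgebraic huP)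
  have h3 := trdeg_adjoin_le_two_mul z
  exact_mod_cast h1.trans (h2.trans h3)

/-- **S ⟹ Sat** (drop the saturation hypothesis). -/
theorem saturated_of_schanuel (hS : _root_.Schanuel) :
    ∀ (n : ℕ) (z : Fin n → ℂ), LinearIndependent ℚ z → (∀ w : ℂ, IsAlgebraic ↥(IntermediateField.adjoin ℚ (Set.range z ∪ Set.range (Complex.exp ∘ z))) w → IsAlgebraic ↥(IntermediateField.adjoin ℚ (Set.range z ∪ Set.range (Complex.exp ∘ z))) (Complex.exp w) → w ∈ Submodule.span ℚ (Set.range z)) → (n : Cardinal) ≤ Algebra.trdeg ℚ ↥(IntermediateField.adjoin ℚ (Set.range z ∪ Set.range (Complex.exp ∘ z))) :=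
  fun n z hz _ => hS n z hz

/-- **ROOT CUT (generation 25).**  `Schanuel ⟺ FinitarySaturation ∧ SaturatedSchanuel` (the second conjunct = stmt-Schanuel-25021,
verbatim): Schanuel's conjecture is exactly «every finitely generated field has an E-saturation of finite rank» plus «Schanuel's
inequality at saturated tuples». -/
theorem schanuel_iff_finitarySaturation_and_saturated :
    _root_.Schanuel ↔ (FinitarySaturation ∧
      ∀ (n : ℕ) (z : Fin n → ℂ), LinearIndependent ℚ z → (∀ w : ℂ, IsAlgebraic ↥(IntermediateField.adjoin ℚ (Set.range z ∪ Set.range (Complex.exp ∘ z))) w → IsAlgebraic ↥(IntermediateField.adjoin ℚ (Set.range z ∪ Set.range (Complex.exp ∘ z))) (Complex.exp w) → w ∈ Submodule.span ℚ (Set.range z)) → (n : Cardinal) ≤ Algebra.trdeg ℚ ↥(IntermediateField.adjoin ℚ (Set.range z ∪ Set.range (Complex.exp ∘ z)))) :=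
  ⟨fun hS => ⟨finitarySaturation_of_schanuel hS, saturated_of_schanuel hS⟩,
    fun h => schanuel_of_finitarySaturation_of_saturated h.1 h.2⟩

/-! ## The ladder below `FS` and above it -/

/-- **URB ⟹ FS.**  A uniform rank bound `rank Γ(K) ≤ f(trdeg K)` on finitely generated fields (stmt-Schanuel-3490, verbatim) bounds
the saturation rank: apply `f` to `K = ℚ(z, e^z, u, e^u)`, which is finitely generated of the same transcendence degree as `F_z`. -/
theorem finitarySaturation_of_uniformRankBound
    (hU : ∃ f : ℕ → ℕ, ∀ K : IntermediateField ℚ ℂ, K.FG → ∀ (n : ℕ) (u : Fin n → ℂ), (∀ i, u i ∈ K ∧ Complex.exp (u i) ∈ K) → LinearIndependent ℚ u → n ≤ f (Cardinal.toNat (Algebra.trdeg ℚ K))) :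
    FinitarySaturation := by
  obtain ⟨f, hf⟩ := hU
  intro n z
  refine ⟨f (Cardinal.toNat (Algebra.trdeg ℚ ↥(adjoin ℚ (Set.range z ∪ Set.range (cexp ∘ z))))), fun m u huP hu => ?_⟩
  set S : Set ℂ := Set.range z ∪ Set.range (cexp ∘ z) with hS
  set T : Set ℂ := Set.range u ∪ Set.range (cexp ∘ u) with hT
  set K : IntermediateField ℚ ℂ := adjoin ℚ (S ∪ T) with hK
  have hKfg : K.FG := fg_adjoin_of_finite
    (((Set.finite_range z).union (Set.finite_range _)).union ((Set.finite_range u).union (Set.finite_range _)))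
  have huK : ∀ i, u i ∈ K ∧ cexp (u i) ∈ K := fun i =>
    ⟨subset_adjoin ℚ _ (Or.inr (Or.inl ⟨i, rfl⟩)), subset_adjoin ℚ _ (Or.inr (Or.inr ⟨i, rfl⟩))⟩
  have hgen : ∀ x ∈ T, IsAlgebraic ↥(adjoin ℚ S) x := gens_isAlgebraic_of_expAlgebraic huP
  have htr : Algebra.trdeg ℚ ↥K = Algebra.trdeg ℚ ↥(adjoin ℚ S) :=
    trdeg_adjoin_union_eq_of_isAlgebraic_adjoin S T hgen
  have h := hf K hKfg m u huK hu
  rwa [htr] at h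

/-- **FS ⟹ FG.**  Finitary saturation implies exponential Mordell–Weil (stmt-Schanuel-3489, verbatim): `Γ(K) ⊆ Γ^alg(z)` for any
finite generating tuple `z` of `K`. -/
theorem expMordellWeilFG_of_finitarySaturation (hFS : FinitarySaturation) :
    ∀ K : IntermediateField ℚ ℂ, K.FG → ∃ N : ℕ, ∀ (n : ℕ) (u : Fin n → ℂ), (∀ i, u i ∈ K ∧ Complex.exp (u i) ∈ K) → LinearIndependent ℚ u → n ≤ N := by
  intro K hK
  obtain ⟨S, rfl⟩ := hK
  set z : Fin S.card → ℂ := fun i => ((S.equivFin.symm i : ↥S) : ℂ) with hz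
  obtain ⟨N, hN⟩ := hFS S.card z
  have hle : adjoin ℚ (↑S : Set ℂ) ≤ adjoin ℚ (Set.range z ∪ Set.range (cexp ∘ z)) := by
    refine adjoin.mono ℚ _ _ fun x hx => Or.inl ⟨S.equivFin ⟨x, hx⟩, ?_⟩
    simp [hz]
  refine ⟨N, fun n u huK hu => hN n u (fun j => ?_) hu⟩
  exact ⟨isAlgebraic_of_mem_adjoin (hle (huK j).1), isAlgebraic_of_mem_adjoin (hle (huK j).2)⟩

/-- A finitely generated intermediate field has finite transcendence degree. [folklore] -/
theorem trdeg_lt_aleph0_of_fg {K : IntermediateField ℚ ℂ} (hK : K.FG) : Algebra.trdeg ℚ ↥K < ℵ₀ := by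
  obtain ⟨S, rfl⟩ := hK
  exact (trdeg_adjoin_le_nat (F := ℚ) (↑S : Set ℂ) (n := S.card) (by simp)).trans_lt (Cardinal.natCast_lt_aleph0)

/-- **Def_c ⟹ URB** with `f(d) = d + c`: Schanuel with defect `≤ c` gives the uniform exponential-rank bound (stmt-Schanuel-3490,
verbatim conclusion). -/
theorem uniformRankBound_of_defectLe (c : ℕ)
    (hc : ∀ (n : ℕ) (z : Fin n → ℂ), LinearIndependent ℚ z →
      (n : Cardinal) ≤ Algebra.trdeg ℚ ↥(IntermediateField.adjoin ℚ (Set.range z ∪ Set.range (Complex.exp ∘ z))) + c) :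
    ∃ f : ℕ → ℕ, ∀ K : IntermediateField ℚ ℂ, K.FG → ∀ (n : ℕ) (u : Fin n → ℂ), (∀ i, u i ∈ K ∧ Complex.exp (u i) ∈ K) → LinearIndependent ℚ u → n ≤ f (Cardinal.toNat (Algebra.trdeg ℚ K)) := by
  refine ⟨fun d => d + c, fun K hK n u huK hu => ?_⟩
  have h1 := hc n u hu
  have h2 : Algebra.trdeg ℚ ↥(adjoin ℚ (Set.range u ∪ Set.range (cexp ∘ u))) ≤ Algebra.trdeg ℚ ↥K :=
    trdeg_mono (adjoin_le_of_mem huK)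
  have hcast : ((Cardinal.toNat (Algebra.trdeg ℚ ↥K) : ℕ) : Cardinal) = Algebra.trdeg ℚ ↥K :=
    Cardinal.cast_toNat_of_lt_aleph0 (trdeg_lt_aleph0_of_fg hK)
  have h3 : (n : Cardinal) ≤ ((Cardinal.toNat (Algebra.trdeg ℚ ↥K) + c : ℕ) : Cardinal) := by
    rw [Nat.cast_add, hcast]
    exact h1.trans (add_le_add h2 le_rfl)
  exact_mod_cast h3

/-- **B ⟹ URB** (new cross-route edge stmt-Schanuel-25020 ⟹ stmt-Schanuel-3490; both verbatim): one-defect Schanuel gives the uniform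
rank bound with `f(d) = d + 1`. -/
theorem uniformRankBound_of_defectOne
    (hB : ∀ (n : ℕ) (z : Fin n → ℂ), LinearIndependent ℚ z → (n : Cardinal) ≤ Algebra.trdeg ℚ ↥(IntermediateField.adjoin ℚ (Set.range z ∪ Set.range (Complex.exp ∘ z))) + 1) :
    ∃ f : ℕ → ℕ, ∀ K : IntermediateField ℚ ℂ, K.FG → ∀ (n : ℕ) (u : Fin n → ℂ), (∀ i, u i ∈ K ∧ Complex.exp (u i) ∈ K) → LinearIndependent ℚ u → n ≤ f (Cardinal.toNat (Algebra.trdeg ℚ K)) :=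
  uniformRankBound_of_defectLe 1 (by simpa using hB)

/-- **S ⟹ Def_c** (trivial top of the ladder). -/
theorem defectLe_of_schanuel (c : ℕ) (hS : _root_.Schanuel) :
    ∀ (n : ℕ) (z : Fin n → ℂ), LinearIndependent ℚ z →
      (n : Cardinal) ≤ Algebra.trdeg ℚ ↥(IntermediateField.adjoin ℚ (Set.range z ∪ Set.range (Complex.exp ∘ z))) + c :=
  fun n z hz => (hS n z hz).trans (self_le_add_right _ _)

/-- **S ⟹ URB** (with `f = id`, through `Def_0`). -/
theorem uniformRankBound_of_schanuel (hS : _root_.Schanuel) :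
    ∃ f : ℕ → ℕ, ∀ K : IntermediateField ℚ ℂ, K.FG → ∀ (n : ℕ) (u : Fin n → ℂ), (∀ i, u i ∈ K ∧ Complex.exp (u i) ∈ K) → LinearIndependent ℚ u → n ≤ f (Cardinal.toNat (Algebra.trdeg ℚ K)) :=
  uniformRankBound_of_defectLe 0 (by simpa using defectLe_of_schanuel 0 hS)

/-- **B ⟹ FS** and **Def_c ⟹ FS** (composition). -/
theorem finitarySaturation_of_defectLe (c : ℕ)
    (hc : ∀ (n : ℕ) (z : Fin n → ℂ), LinearIndependent ℚ z →
      (n : Cardinal) ≤ Algebra.trdeg ℚ ↥(IntermediateField.adjoin ℚ (Set.range z ∪ Set.range (Complex.exp ∘ z))) + c) :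
    FinitarySaturation :=
  finitarySaturation_of_uniformRankBound (uniformRankBound_of_defectLe c hc)

/-! ## Return maps from the lower rungs -/

/-- **URB ∧ Sat ⟹ S** (new return edge stmt-Schanuel-3490 ∧ stmt-Schanuel-25021 ⟹ summit; both verbatim). -/
theorem schanuel_of_uniformRankBound_of_saturated
    (hU : ∃ f : ℕ → ℕ, ∀ K : IntermediateField ℚ ℂ, K.FG → ∀ (n : ℕ) (u : Fin n → ℂ), (∀ i, u i ∈ K ∧ Complex.exp (u i) ∈ K) → LinearIndependent ℚ u → n ≤ f (Cardinal.toNat (Algebra.trdeg ℚ K)))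
    (hSat : ∀ (n : ℕ) (z : Fin n → ℂ), LinearIndependent ℚ z → (∀ w : ℂ, IsAlgebraic ↥(IntermediateField.adjoin ℚ (Set.range z ∪ Set.range (Complex.exp ∘ z))) w → IsAlgebraic ↥(IntermediateField.adjoin ℚ (Set.range z ∪ Set.range (Complex.exp ∘ z))) (Complex.exp w) → w ∈ Submodule.span ℚ (Set.range z)) → (n : Cardinal) ≤ Algebra.trdeg ℚ ↥(IntermediateField.adjoin ℚ (Set.range z ∪ Set.range (Complex.exp ∘ z)))) :
    _root_.Schanuel :=
  schanuel_of_finitarySaturation_of_saturated (finitarySaturation_of_uniformRankBound hU) hSat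

/-- `Schanuel ⟺ UniformRankBound ∧ SaturatedSchanuel` (stmt-Schanuel-3490 ∧ stmt-Schanuel-25021, verbatim). -/
theorem schanuel_iff_uniformRankBound_and_saturated :
    _root_.Schanuel ↔
      ((∃ f : ℕ → ℕ, ∀ K : IntermediateField ℚ ℂ, K.FG → ∀ (n : ℕ) (u : Fin n → ℂ), (∀ i, u i ∈ K ∧ Complex.exp (u i) ∈ K) → LinearIndependent ℚ u → n ≤ f (Cardinal.toNat (Algebra.trdeg ℚ K))) ∧
      ∀ (n : ℕ) (z : Fin n → ℂ), LinearIndependent ℚ z → (∀ w : ℂ, IsAlgebraic ↥(IntermediateField.adjoin ℚ (Set.range z ∪ Set.range (Complex.exp ∘ z))) w → IsAlgebraic ↥(IntermediateField.adjoin ℚ (Set.range z ∪ Set.range (Complex.exp ∘ z))) (Complex.exp w) → w ∈ Submodule.span ℚ (Set.range z)) → (n : Cardinal) ≤ Algebra.trdeg ℚ ↥(IntermediateField.adjoin ℚ (Set.range z ∪ Set.range (Complex.exp ∘ z)))) :=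
  ⟨fun hS => ⟨uniformRankBound_of_schanuel hS, saturated_of_schanuel hS⟩,
    fun h => schanuel_of_uniformRankBound_of_saturated h.1 h.2⟩

/-- **Def_c ∧ Sat ⟹ S** for every `c` (the `c = 1` row is 1E's `schanuel_iff_defectOne_and_saturated`). -/
theorem schanuel_of_defectLe_of_saturated (c : ℕ)
    (hc : ∀ (n : ℕ) (z : Fin n → ℂ), LinearIndependent ℚ z →
      (n : Cardinal) ≤ Algebra.trdeg ℚ ↥(IntermediateField.adjoin ℚ (Set.range z ∪ Set.range (Complex.exp ∘ z))) + c)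
    (hSat : ∀ (n : ℕ) (z : Fin n → ℂ), LinearIndependent ℚ z → (∀ w : ℂ, IsAlgebraic ↥(IntermediateField.adjoin ℚ (Set.range z ∪ Set.range (Complex.exp ∘ z))) w → IsAlgebraic ↥(IntermediateField.adjoin ℚ (Set.range z ∪ Set.range (Complex.exp ∘ z))) (Complex.exp w) → w ∈ Submodule.span ℚ (Set.range z)) → (n : Cardinal) ≤ Algebra.trdeg ℚ ↥(IntermediateField.adjoin ℚ (Set.range z ∪ Set.range (Complex.exp ∘ z)))) :
    _root_.Schanuel :=
  schanuel_of_finitarySaturation_of_saturated (finitarySaturation_of_defectLe c hc) hSat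

/-! ## The dictionary row `Def_c ⟺ exponential-rank excess ≤ c` -/

/-- **Dictionary.**  Schanuel with defect `≤ c` ⟺ every subfield `K ⊆ ℂ` carries at most `trdeg K + c` ℚ-independent exponential
periods (`c = 0`: `Theorems.schanuel_iff_forall_expRank_le_trdeg`; `c = 1`: DefectOneSchanuel). -/
theorem defectLe_iff_expRankExcess (c : ℕ) :
    (∀ (n : ℕ) (z : Fin n → ℂ), LinearIndependent ℚ z →
      (n : Cardinal) ≤ Algebra.trdeg ℚ ↥(IntermediateField.adjoin ℚ (Set.range z ∪ Set.range (Complex.exp ∘ z))) + c) ↔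
    (∀ (K : IntermediateField ℚ ℂ) (n : ℕ) (u : Fin n → ℂ), (∀ i, u i ∈ K ∧ Complex.exp (u i) ∈ K) →
      LinearIndependent ℚ u → (n : Cardinal) ≤ Algebra.trdeg ℚ ↥K + c) := by
  constructor
  · intro hc K n u huK hu
    exact (hc n u hu).trans (add_le_add (trdeg_mono (adjoin_le_of_mem huK)) le_rfl)
  · intro h n z hz
    exact h _ n z (fun i => ⟨subset_adjoin ℚ _ (Or.inl ⟨i, rfl⟩), subset_adjoin ℚ _ (Or.inr ⟨i, rfl⟩)⟩) hz

/-! ## The decided grade-0 cell of `FS` -/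

/-- Anything algebraic over `F_z` for the EMPTY tuple `z` (so `F_z = ℚ`) is algebraic over `ℚ`. -/
theorem isAlgebraic_rat_of_isAlgebraic_adjoin_empty (z : Fin 0 → ℂ) {w : ℂ}
    (hw : IsAlgebraic ↥(adjoin ℚ (Set.range z ∪ Set.range (cexp ∘ z))) w) : IsAlgebraic ℚ w := by
  have hbot : ∀ x ∈ Set.range z ∪ Set.range (cexp ∘ z), IsAlgebraic ↥(⊥ : IntermediateField ℚ ℂ) x := by
    rintro x (⟨j, _⟩ | ⟨j, _⟩) <;> exact j.elim0
  have h1 : IsAlgebraic ↥(⊥ : IntermediateField ℚ ℂ) w := isAlgebraic_of_isAlgebraic_adjoin ⊥ hbot hw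
  haveI : Algebra.IsIntegral ℚ ↥(⊥ : IntermediateField ℚ ℂ) := Algebra.IsIntegral.of_finite ℚ _
  exact isAlgebraic_iff_isIntegral.mpr (isIntegral_trans (R := ℚ) (A := ↥(⊥ : IntermediateField ℚ ℂ)) w
    (isAlgebraic_iff_isIntegral.mp h1))

/-- **Grade 0 of `FS` is a theorem (Hermite–Lindemann).**  For the empty tuple, `Γ^alg(∅) = {w : w, e^w ∈ ℚ̄} = 0`, so every
ℚ-l.i. family in it is empty: the bound `N = 0` holds. -/
theorem finitarySaturation_rank_zero (z : Fin 0 → ℂ) :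
    ∃ N : ℕ, ∀ (m : ℕ) (u : Fin m → ℂ),
      (∀ j, IsAlgebraic ↥(IntermediateField.adjoin ℚ (Set.range z ∪ Set.range (Complex.exp ∘ z))) (u j) ∧
          IsAlgebraic ↥(IntermediateField.adjoin ℚ (Set.range z ∪ Set.range (Complex.exp ∘ z))) (Complex.exp (u j))) →
      LinearIndependent ℚ u → m ≤ N := by
  refine ⟨0, fun m u huP hu => ?_⟩
  have hzero : ∀ j, u j = 0 := by
    intro j
    by_contra hj
    exact transcendental_exp_holds (isAlgebraic_rat_of_isAlgebraic_adjoin_empty z (huP j).1) hj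
      (isAlgebraic_rat_of_isAlgebraic_adjoin_empty z (huP j).2)
  rcases Nat.eq_zero_or_pos m with rfl | hm
  · exact le_rfl
  · exact absurd (hzero ⟨0, hm⟩) (hu.ne_zero _)

end Summit.Schanuel.Schanuel.Theorems.RootDecomp1SaturationLadder
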